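import Mathlib
import Summits.NavierStokesRegularity.NavierStokesRegularity.Theorems.TaoLadderRungTwoFlatAheadCuts
import HarnessLib

/-!
# The ENVELOPE obligation `TubeStepEnvelopeWith`, first pieces: exact premise flows have energies `F = ½S²`, so the envelope is an
  amplitude bound shell by shell; the AHEAD part follows from the cut schedule (helper for the K_A♭ parent item
  stmt-NavierStokesRegularity-22987 `FlatGapCertificatesV2`, route TaoLadderRungTwoFlat; cell harvest/h2-tao-ladder, p1 g24; LADDER §50.8–50.9, §62)

`HopTube.TubeStepEnvelopeWith … env₀ … n` asks `F i k s ≤ env₀ k` for every shell along the hop up to the section time. For the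
zero-slack exact premise flows of `HopPremiseWith` (`κ₁ = κ₂ = 0`, `B₀ = 0`) the format clause (4.10) pins `F = ½S²`, so the obligation
is a family of AMPLITUDE bounds; this module records that reduction and discharges the AHEAD shells from the cuts of …AheadCuts:

* `energy_le_half_sq_of_premiseFlow` — `F i k s ≤ ½·(S i k s)²` on `[0, τ]` for a zero-slack exact flow;
* `epochEnvelope_of_abs_le` — amplitude bounds `|S i k s| ≤ a k` with `½·(a k)² ≤ env₀ k` give `epochEnvelope env₀ (S·s) (F·s)`;
* `envelopeAhead_of_cuts` — along every premise flow of hop `n`, at every `s ∈ [0, c₀]` and every shell `m > k_H + 1`, the cut at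
  `m − 1` gives `F i m s ≤ ½(2G_{m−1})²`, hence `≤ env₀ m` under the scalar row `2·G(m−1)² ≤ env₀ m` (the remaining shells — window,
  interface, near, behind — are the other zones' in-hop bounds: E2 hull, interface levels, near amplitude, `R54.behind_blockEnergy_le_of_apriori`).

HONEST FRAMING: bookkeeping over MODEL-lattice certificate flows (graded mirror table on `S♭`); the cut schedule and the envelope rows are
HYPOTHESES; nothing certified; no item closed; nothing about the Navier–Stokes equations.
-/

noncomputable section

-- the sub-problem namespace repeats the summit name by design (D-0017)
set_option linter.dupNamespace false

namespace Summit.NavierStokesRegularity.NavierStokesRegularity.Theorems.HopTube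

open Set Finset Literature.Analysis.FluidPDE Literature.Analysis.FluidPDE.TaoCascade MirrorPulse

/-- **Zero-slack exact flows have `F ≤ ½S²`** ((4.10) upper with `B₀ = 0`, `κ₂ = 0`). [cite: Tao2016AveragedNS, §4 Lemma 4.1 (4.10) (statement shape); cell LADDER §50.8 (envelope obligation)] -/
theorem energy_le_half_sq_of_premiseFlow {𝕊 : Finset (ℤ × ℤ × ℤ)} {τ ε₀ : ℝ} {m : ℕ} {α : Fin m → Fin m → Fin m → ℤ × ℤ × ℤ → ℝ}
    {S₀ : Fin m → ℤ → ℝ} {S F : Fin m → ℤ → ℝ → ℝ}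
    (h : PseudoFlowOnShift 𝕊 τ ε₀ α 0 0 S₀ (fun i k => (1 / 2) * S₀ i k ^ 2) (fun _ _ => 0) S F) {s : ℝ} (hs : s ∈ Icc 0 τ)
    (i : Fin m) (k : ℤ) : F i k s ≤ (1 / 2) * S i k s ^ 2 := by
  have hup := h.defect_upper i k s hs
  simp only [zero_mul, add_zero] at hup
  exact hup

/-- **Amplitude bounds give the envelope**: `|S i k s| ≤ a k`, `F i k s ≤ ½(S i k s)²` and `½·(a k)² ≤ env₀ k` for all shells give
`epochEnvelope env₀ (S·s) (F·s)`. [cite: Tao2016AveragedNS, §6.2 Prop. 6.3 (ix) (statement shape); cell LADDER §50.8–50.9 (`tubeEnv`)] -/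
theorem epochEnvelope_of_abs_le {m : ℕ} {env₀ a : ℤ → ℝ} {S F : Fin m → ℤ → ℝ → ℝ} {s : ℝ}
    (hF : ∀ i k, F i k s ≤ (1 / 2) * S i k s ^ 2) (hS : ∀ i k, |S i k s| ≤ a k) (henv : ∀ k, (1 / 2) * a k ^ 2 ≤ env₀ k) :
    epochEnvelope env₀ (fun i k => S i k s) (fun i k => F i k s) := by
  intro i k
  have h1 : S i k s ^ 2 ≤ a k ^ 2 := by
    rw [← sq_abs]; exact pow_le_pow_left₀ (abs_nonneg _) (hS i k) 2
  calc F i k s ≤ (1 / 2) * S i k s ^ 2 := hF i k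
    _ ≤ (1 / 2) * a k ^ 2 := by linarith
    _ ≤ env₀ k := henv k

section Ahead

variable {ε ε₀ : ℝ} {P : TubeSchedule} {Bcl : ℕ → (Fin 2 → ℤ → ℝ) → Prop} {i₀ : Fin 2} {X₀ : Fin 2 → ℝ} {w : ℤ → ℝ}
  {r c₀ : ℝ} {ζ : ℕ → Fin 2 → ℤ → ℝ} {ustar : Fin 2 → ℤ → ℝ} {n : ℕ}

/-- **AHEAD PART OF THE ENVELOPE from the cuts**: cut envelopes `G_j` beyond every `j > k_H` (`AheadCutBoundWith`, e.g. from
`aheadCuts_of_schedule`) and the scalar row `2·G(m−1)² ≤ env₀ m` give `F i m s ≤ env₀ m` at every `s ∈ [0, c₀]` and every shell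
`m > k_H + 1`, along every premise flow of hop `n`. [cite: Tao2016AveragedNS, §6.2 Prop. 6.3 (ix); cell LADDER §50.9 (`tubeEnv` ahead branch), §62 (AHEAD-TAIL-62)] -/
theorem envelopeAhead_of_cuts {kH : ℤ} {G env₀ : ℤ → ℝ}
    (hcut : ∀ k, kH < k → AheadCutBoundWith P Bcl shiftSetFlat ε₀ i₀ (mirrorTable ε ε) X₀ w r c₀ ζ ustar n k (G k))
    (henv : ∀ m, kH + 1 < m → 2 * G (m - 1) ^ 2 ≤ env₀ m) :
    ∀ z S₀ τ S F, HopPremiseWith P Bcl shiftSetFlat ε₀ i₀ (mirrorTable ε ε) X₀ w r c₀ ζ ustar n z S₀ τ S F →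
      ∀ s ∈ Icc 0 c₀, ∀ (i : Fin 2) (m : ℤ), kH + 1 < m → F i m s ≤ env₀ m := by
  intro z S₀ τ S F hprem s hs i m hm
  have hS : |S i m s| ≤ 2 * G (m - 1) := hcut (m - 1) (by omega) z S₀ τ S F hprem s hs i m (by omega)
  obtain ⟨-, -, hc₀τ, hflow⟩ := hprem
  have hF := energy_le_half_sq_of_premiseFlow hflow ⟨hs.1, hs.2.trans hc₀τ⟩ i m
  have hG0 : 0 ≤ 2 * G (m - 1) := (abs_nonneg _).trans hS
  have h1 : S i m s ^ 2 ≤ (2 * G (m - 1)) ^ 2 := by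
    rw [← sq_abs]; exact pow_le_pow_left₀ (abs_nonneg _) hS 2
  calc F i m s ≤ (1 / 2) * S i m s ^ 2 := hF
    _ ≤ (1 / 2) * (2 * G (m - 1)) ^ 2 := by linarith
    _ = 2 * G (m - 1) ^ 2 := by ring
    _ ≤ env₀ m := henv m hm

end Ahead

end Summit.NavierStokesRegularity.NavierStokesRegularity.Theorems.HopTube

end
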